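import Summits.ValiantsHypothesis.ValiantsHypothesis.Theorems.GrenetZeonDualUnipotentThreeHalvesHeavyTopThmCTraceKit

/-!
# `GrenetZeon.DualUnipotentThreeHalves` (stmt-ValiantsHypothesis-24318), R2 heavy-top instrument — THEOREM C(n) PORT, FRAME 1 (general size `n`):
# the trace-orthogonality COUNT for a graded nilpotent space `W ≤ M_n(ℂ)` containing the shift

Experiment cell «val-heavytop-census» (D-0160), engine seat val-htc-eng-1 g4.  Size-general version of ✓ `…ThmCGradedCount` (which is the case `n = 7`).  For a linear space `W ≤ M_n(ℂ)` of nilpotent matrices that is GRADED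
(stable under every height projection `π_d`, height of `(a,b)` = `b − a`) and contains `J = Σ E_{i,i+1}`, put, for `1 ≤ h ≤ n − 1`,
`P_h := {(A_{i,i+h})_i : A ∈ W}` and `N_h := {(A_{i+h,i})_i : A ∈ W}` (subspaces of `ℂ^{n−h}`, images of `W` under the diagonal-extraction maps
`dp h`, `dm h`, passed as arguments with their entry formulas).  THIS FILE proves (lead g0 ROADMAP-codim1 §1 «slack identity», kernel form):

* `shiftPow_apply` — `(J^h)_{ab} = [b = a + h]`;  `diag_eq_zero` — members of `W` have zero diagonal;
* `sum_dite_eq_sum_fin`, `trace_projNeg_mul` — `tr(π_{−h}(B) M) = Σ_{i<n−h} B_{i+h,i} M_{i,i+h}`;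
* `dot_eq_zero` (`N_h ⊥ P_h` for the dot product: polarised `tr(XY) = 0`), `dot_one_eq_zero` (`Σ_i q_i = 0` on `N_h`: `tr(J^h Y) = 0`);
* `finrank_add_le`, `finrank_add_succ_le` — `dim P_h + dim N_h ≤ n − h`, and `≤ n − h − 1` when `𝟙 ∉ P_h` (annihilator count ✓ `…ThmCTraceKit`);
* ★ `finrank_le_sum` — `dim W ≤ Σ_{h=1}^{n−1} (dim P_h + dim N_h)` (a member of `W` is determined by its off-diagonal entries).

Honest framing: infrastructure for the instrument's kernel ports of Thm C(n) (n = 5, 6, …); nothing here proves or refutes `HeavyTopLaw`/`HeavyTopSlowLaw`, 24318, S3 or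
8062; `VP ≠ VNP` is NOT proved.  No definitions.  [lead g0 ROADMAP-codim1 §1; this seat]
-/

noncomputable section

-- single-conjunct layout: Sub = Summit, duplicated namespace component intended
set_option linter.dupNamespace false

namespace Summit.ValiantsHypothesis.ValiantsHypothesis.Theorems.GrenetZeon.HeavyTopThmCnGradedCount

open Matrix
open Summit.ValiantsHypothesis.ValiantsHypothesis.Theorems.GrenetZeon.HeavyTopThmCTraceKit
  (trace_pow_eq_zero_of_isNilpotent trace_mul_eq_zero_of_mem trace_mul_pow_eq_zero_of_mem finrank_add_finrank_le_of_dotProduct_eq_zero)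

/-! ## The shift and its powers -/

/-- Entries of the powers of the full shift: `(J^h)_{ab} = [b = a + h]`. -/
theorem shiftPow_apply {n : ℕ} (h : ℕ) (a b : Fin n) :
    ((Matrix.of fun a b : Fin n => if (b : ℕ) = (a : ℕ) + 1 then (1 : ℂ) else 0) ^ h) a b =
      if (b : ℕ) = (a : ℕ) + h then (1 : ℂ) else 0 := by
  induction h generalizing a b with
  | zero => simp [Matrix.one_apply, Fin.ext_iff, eq_comm]
  | succ h ih =>
    rw [pow_succ, Matrix.mul_apply]
    by_cases hb : (b : ℕ) = (a : ℕ) + (h + 1)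
    · rw [if_pos hb, Finset.sum_eq_single ⟨(a : ℕ) + h, by omega⟩]
      · rw [ih, Matrix.of_apply, if_pos rfl, if_pos (by simp; omega), one_mul]
      · intro k _ hk
        rw [ih]
        have : ¬ ((k : ℕ) = (a : ℕ) + h) := fun e => hk (Fin.ext (by simp [e]))
        rw [if_neg this, zero_mul]
      · intro hh; exact absurd (Finset.mem_univ _) hh
    · rw [if_neg hb]
      refine Finset.sum_eq_zero fun k _ => ?_
      rw [ih, Matrix.of_apply]
      by_cases hk : (k : ℕ) = (a : ℕ) + h
      · rw [if_pos hk, if_neg (by omega), mul_zero]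
      · rw [if_neg hk, zero_mul]

/-! ## Zero diagonal -/

/-- In a graded space of nilpotent matrices every member has zero diagonal (`π_0 A` is diagonal and nilpotent). -/
theorem diag_eq_zero {n : ℕ} (W : Submodule ℂ (Matrix (Fin n) (Fin n) ℂ)) (hW : ∀ A ∈ W, IsNilpotent A)
    (hgr : ∀ A ∈ W, ∀ d : ℤ, (Matrix.of fun a b : Fin n => if (b : ℤ) - (a : ℤ) = d then A a b else 0) ∈ W)
    (A : Matrix (Fin n) (Fin n) ℂ) (hA : A ∈ W) (i : Fin n) : A i i = 0 := by
  have h0 := hgr A hA 0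
  set D : Matrix (Fin n) (Fin n) ℂ := Matrix.of fun a b : Fin n => if (b : ℤ) - (a : ℤ) = 0 then A a b else 0 with hD
  have hDdiag : D = Matrix.diagonal fun j => A j j := by
    ext a b
    rw [hD, Matrix.of_apply, Matrix.diagonal_apply]
    by_cases hab : a = b
    · subst hab; simp
    · have : ¬ ((b : ℤ) - (a : ℤ) = 0) := fun e => hab (Fin.ext (by omega))
      rw [if_neg this, if_neg hab]
  obtain ⟨k, hk⟩ := hW D h0
  rw [hDdiag, Matrix.diagonal_pow] at hk
  have := congr_fun (congr_fun hk i) i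
  simp only [Matrix.diagonal_apply_eq, Pi.pow_apply, Matrix.zero_apply] at this
  exact pow_eq_zero_iff' |>.mp this |>.1

/-! ## Traces against a lower projection -/

/-- Reindexing: a dependent sum over `Fin n` supported on `b + h < n` is a sum over `Fin (7 − h)`. -/
theorem sum_dite_eq_sum_fin {n : ℕ} (h : ℕ) (F : ∀ b : Fin n, (b : ℕ) + h < n → ℂ) :
    (∑ b : Fin n, if hb : (b : ℕ) + h < n then F b hb else 0) = ∑ i : Fin (n - h), F ⟨(i : ℕ), by omega⟩ (by simp; omega) := by
  classical
  set g : ℕ → ℂ := fun x => if hx : x + h < n then F ⟨x, by omega⟩ hx else 0 with hg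
  have lhs : (∑ b : Fin n, if hb : (b : ℕ) + h < n then F b hb else 0) = ∑ x ∈ Finset.range n, g x := by
    rw [← Fin.sum_univ_eq_sum_range]
  have rhs : (∑ i : Fin (n - h), F ⟨(i : ℕ), by omega⟩ (by simp; omega)) = ∑ x ∈ Finset.range (n - h), g x := by
    rw [← Fin.sum_univ_eq_sum_range]
    refine Finset.sum_congr rfl fun i _ => ?_
    rw [hg]; simp only; rw [dif_pos (by omega)]
  have hfilter : Finset.range (n - h) = (Finset.range n).filter (fun x => x + h < n) := by
    ext x; simp only [Finset.mem_filter, Finset.mem_range]; omega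
  rw [lhs, rhs, hfilter, Finset.sum_filter]
  refine Finset.sum_congr rfl fun x _ => ?_
  by_cases hx : x + h < n
  · rw [if_pos hx]
  · rw [if_neg hx, hg]; simp only; rw [dif_neg hx]

/-- `tr(π_{−h}(B) · M) = Σ_{i<7−h} B_{i+h,i} M_{i,i+h}`. -/
theorem trace_projNeg_mul {n : ℕ} (h : ℕ) (B M : Matrix (Fin n) (Fin n) ℂ) :
    Matrix.trace ((Matrix.of fun a b : Fin n => if (b : ℤ) - (a : ℤ) = -(h : ℤ) then B a b else 0) * M) =
      ∑ i : Fin (n - h), B ⟨(i : ℕ) + h, by omega⟩ ⟨(i : ℕ), by omega⟩ * M ⟨(i : ℕ), by omega⟩ ⟨(i : ℕ) + h, by omega⟩ := by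
  classical
  rw [Matrix.trace]
  simp only [Matrix.diag_apply, Matrix.mul_apply, Matrix.of_apply]
  rw [Finset.sum_comm]
  -- inner sum over `a` collapses to `a = b + h`
  have inner : ∀ b : Fin n, (∑ a : Fin n, (if (b : ℤ) - (a : ℤ) = -(h : ℤ) then B a b else 0) * M b a) =
      if hb : (b : ℕ) + h < n then B ⟨(b : ℕ) + h, hb⟩ b * M b ⟨(b : ℕ) + h, hb⟩ else 0 := by
    intro b
    by_cases hb : (b : ℕ) + h < n
    · rw [dif_pos hb, Finset.sum_eq_single ⟨(b : ℕ) + h, hb⟩]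
      · rw [if_pos (by simp)]
      · intro a _ ha
        have : ¬ ((b : ℤ) - (a : ℤ) = -(h : ℤ)) := fun e => ha (Fin.ext (by simp; omega))
        rw [if_neg this, zero_mul]
      · intro hh; exact absurd (Finset.mem_univ _) hh
    · rw [dif_neg hb]
      refine Finset.sum_eq_zero fun a _ => ?_
      have : ¬ ((b : ℤ) - (a : ℤ) = -(h : ℤ)) := fun e => hb (by have := a.isLt; omega)
      rw [if_neg this, zero_mul]
  rw [Finset.sum_congr rfl fun b _ => inner b,
    sum_dite_eq_sum_fin h (fun b hb => B ⟨(b : ℕ) + h, hb⟩ b * M b ⟨(b : ℕ) + h, hb⟩)]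

/-! ## Orthogonality and the per-height bound -/

/-- ★ `N_h ⊥ P_h` for the dot product (polarised `tr(XY) = 0` on the graded pieces). -/
theorem dot_eq_zero {n : ℕ} (W : Submodule ℂ (Matrix (Fin n) (Fin n) ℂ)) (hW : ∀ A ∈ W, IsNilpotent A)
    (hgr : ∀ A ∈ W, ∀ d : ℤ, (Matrix.of fun a b : Fin n => if (b : ℤ) - (a : ℤ) = d then A a b else 0) ∈ W) (h : ℕ)
    (dp dm : Matrix (Fin n) (Fin n) ℂ →ₗ[ℂ] (Fin (n - h) → ℂ))
    (hdp : ∀ A (i : Fin (n - h)) (a b : Fin n), (a : ℕ) = i → (b : ℕ) = i + h → dp A i = A a b)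
    (hdm : ∀ A (i : Fin (n - h)) (a b : Fin n), (a : ℕ) = i + h → (b : ℕ) = i → dm A i = A a b) :
    ∀ q ∈ W.map dm, ∀ p ∈ W.map dp, q ⬝ᵥ p = 0 := by
  rintro _ ⟨B, hB, rfl⟩ _ ⟨A, hA, rfl⟩
  have ht := trace_mul_eq_zero_of_mem W hW (hgr B hB (-(h : ℤ))) (hgr A hA h)
  rw [trace_projNeg_mul] at ht
  rw [dotProduct, ← ht]
  refine Finset.sum_congr rfl fun i _ => ?_
  rw [hdm B i ⟨(i : ℕ) + h, by omega⟩ ⟨(i : ℕ), by omega⟩ rfl rfl, hdp A i ⟨(i : ℕ), by omega⟩ ⟨(i : ℕ) + h, by omega⟩ rfl rfl,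
    Matrix.of_apply, if_pos (by simp)]

/-- `Σ_i q_i = 0` on `N_h` (`h ≥ 1`; first-order identity `tr(J^h Y) = 0`). -/
theorem dot_one_eq_zero {n : ℕ} (W : Submodule ℂ (Matrix (Fin n) (Fin n) ℂ)) (hW : ∀ A ∈ W, IsNilpotent A)
    (hgr : ∀ A ∈ W, ∀ d : ℤ, (Matrix.of fun a b : Fin n => if (b : ℤ) - (a : ℤ) = d then A a b else 0) ∈ W)
    (hJ : (Matrix.of fun a b : Fin n => if (b : ℕ) = (a : ℕ) + 1 then (1 : ℂ) else 0) ∈ W) (h : ℕ)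
    (dm : Matrix (Fin n) (Fin n) ℂ →ₗ[ℂ] (Fin (n - h) → ℂ)) (hdm : ∀ A (i : Fin (n - h)) (a b : Fin n), (a : ℕ) = i + h → (b : ℕ) = i → dm A i = A a b) :
    ∀ q ∈ W.map dm, q ⬝ᵥ (fun _ => (1 : ℂ)) = 0 := by
  rintro _ ⟨B, hB, rfl⟩
  have ht := trace_mul_pow_eq_zero_of_mem W hW hJ (hgr B hB (-(h : ℤ))) h
  rw [trace_projNeg_mul] at ht
  rw [dotProduct, ← ht]
  refine Finset.sum_congr rfl fun i _ => ?_
  rw [hdm B i ⟨(i : ℕ) + h, by omega⟩ ⟨(i : ℕ), by omega⟩ rfl rfl, shiftPow_apply, if_pos (by simp), mul_one]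

/-- **Per-height bound**: `dim P_h + dim N_h ≤ 7 − h`. -/
theorem finrank_add_le {n : ℕ} (h : ℕ) (P N : Submodule ℂ (Fin (n - h) → ℂ)) (hPN : ∀ q ∈ N, ∀ p ∈ P, q ⬝ᵥ p = 0) :
    Module.finrank ℂ P + Module.finrank ℂ N ≤ n - h := by
  have := finrank_add_finrank_le_of_dotProduct_eq_zero P N hPN
  omega

/-- **Per-height bound with a missing power**: if moreover `Σ_i q_i = 0` on `N_h` and `𝟙 ∉ P_h`, then `dim P_h + dim N_h + 1 ≤ 7 − h`. -/
theorem finrank_add_succ_le {n : ℕ} (h : ℕ) (P N : Submodule ℂ (Fin (n - h) → ℂ)) (hPN : ∀ q ∈ N, ∀ p ∈ P, q ⬝ᵥ p = 0)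
    (hN1 : ∀ q ∈ N, q ⬝ᵥ (fun _ => (1 : ℂ)) = 0) (hone : (fun _ => (1 : ℂ)) ∉ P) :
    Module.finrank ℂ P + Module.finrank ℂ N + 1 ≤ n - h := by
  have hh : h < n := by
    by_contra hh
    apply hone
    have : (fun _ : Fin (n - h) => (1 : ℂ)) = 0 := funext fun i => absurd i.isLt (by omega)
    rw [this]; exact P.zero_mem
  set Q : Submodule ℂ (Fin (n - h) → ℂ) := P ⊔ (ℂ ∙ (fun _ => (1 : ℂ))) with hQ
  have hNQ : ∀ q ∈ N, ∀ p ∈ Q, q ⬝ᵥ p = 0 := by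
    intro q hq p hp
    rw [hQ, Submodule.mem_sup] at hp
    obtain ⟨y, hy, z, hz, rfl⟩ := hp
    rw [Submodule.mem_span_singleton] at hz
    obtain ⟨t, rfl⟩ := hz
    rw [dotProduct_add, dotProduct_smul, hPN q hq y hy, hN1 q hq, smul_zero, add_zero]
  have hb := finrank_add_finrank_le_of_dotProduct_eq_zero Q N hNQ
  have hdisj : P ⊓ (ℂ ∙ (fun _ => (1 : ℂ))) = ⊥ := by
    rw [← disjoint_iff]
    exact Submodule.disjoint_span_singleton.2 fun h1 => absurd h1 hone
  have hs := Submodule.finrank_sup_add_finrank_inf_eq P (ℂ ∙ (fun _ : Fin (n - h) => (1 : ℂ)))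
  rw [hdisj, finrank_bot, add_zero, finrank_span_singleton] at hs
  · rw [← hQ] at hs
    omega
  · intro h0
    have := congr_fun h0 ⟨0, by omega⟩
    simp at this

/-! ## The total count -/

/-- ★ **A member of `W` is determined by its off-diagonal diagonals**: `dim W ≤ Σ_{h=1}^{6} (dim P_h + dim N_h)`. -/
theorem finrank_le_sum {n : ℕ} (W : Submodule ℂ (Matrix (Fin n) (Fin n) ℂ)) (hW : ∀ A ∈ W, IsNilpotent A)
    (hgr : ∀ A ∈ W, ∀ d : ℤ, (Matrix.of fun a b : Fin n => if (b : ℤ) - (a : ℤ) = d then A a b else 0) ∈ W)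
    (dp dm : ∀ h : ℕ, Matrix (Fin n) (Fin n) ℂ →ₗ[ℂ] (Fin (n - h) → ℂ))
    (hdp : ∀ h A (i : Fin (n - h)) (a b : Fin n), (a : ℕ) = i → (b : ℕ) = i + h → dp h A i = A a b)
    (hdm : ∀ h A (i : Fin (n - h)) (a b : Fin n), (a : ℕ) = i + h → (b : ℕ) = i → dm h A i = A a b) :
    Module.finrank ℂ W ≤ ∑ h : Fin (n - 1), (Module.finrank ℂ (W.map (dp ((h : ℕ) + 1))) + Module.finrank ℂ (W.map (dm ((h : ℕ) + 1)))) := by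
  classical
  -- the comparison map `W → Π_h (P_{h+1} × N_{h+1})`
  let f : ∀ h : Fin (n - 1), W →ₗ[ℂ] W.map (dp ((h : ℕ) + 1)) := fun h =>
    ((dp ((h : ℕ) + 1)).domRestrict W).codRestrict _ (fun x => ⟨x.1, x.2, rfl⟩)
  let g : ∀ h : Fin (n - 1), W →ₗ[ℂ] W.map (dm ((h : ℕ) + 1)) := fun h =>
    ((dm ((h : ℕ) + 1)).domRestrict W).codRestrict _ (fun x => ⟨x.1, x.2, rfl⟩)
  let Φ : W →ₗ[ℂ] (∀ h : Fin (n - 1), W.map (dp ((h : ℕ) + 1)) × W.map (dm ((h : ℕ) + 1))) :=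
    LinearMap.pi fun h => (f h).prod (g h)
  have hΦ : Function.Injective Φ := by
    rw [← LinearMap.ker_eq_bot, LinearMap.ker_eq_bot']
    intro x hx
    have hcomp : ∀ h : Fin (n - 1), dp ((h : ℕ) + 1) x.1 = 0 ∧ dm ((h : ℕ) + 1) x.1 = 0 := by
      intro h
      have e := congr_fun hx h
      exact ⟨congrArg (fun z : ↥(W.map (dp ((h : ℕ) + 1))) × ↥(W.map (dm ((h : ℕ) + 1))) => ((z.1 : ↥(W.map (dp ((h : ℕ) + 1)))) : Fin (n - ((h : ℕ) + 1)) → ℂ)) e,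
          congrArg (fun z : ↥(W.map (dp ((h : ℕ) + 1))) × ↥(W.map (dm ((h : ℕ) + 1))) => ((z.2 : ↥(W.map (dm ((h : ℕ) + 1)))) : Fin (n - ((h : ℕ) + 1)) → ℂ)) e⟩
    apply Subtype.ext
    ext a b
    rw [Submodule.coe_zero, Matrix.zero_apply]
    rcases lt_trichotomy (a : ℕ) (b : ℕ) with hab | hab | hab
    · -- upper entry: read off `dp (b - a)`
      obtain ⟨k, hk⟩ : ∃ k : Fin (n - 1), (k : ℕ) = (b : ℕ) - (a : ℕ) - 1 := ⟨⟨(b : ℕ) - (a : ℕ) - 1, by have := b.isLt; omega⟩, rfl⟩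
      have e := congr_fun (hcomp k).1 ⟨(a : ℕ), by omega⟩
      rw [hdp ((k : ℕ) + 1) x.1 _ a b rfl (by first | omega | (simp; omega)), Pi.zero_apply] at e
      exact e
    · exact (Fin.ext hab) ▸ diag_eq_zero W hW hgr x.1 x.2 a
    · -- lower entry: read off `dm (a - b)`
      obtain ⟨k, hk⟩ : ∃ k : Fin (n - 1), (k : ℕ) = (a : ℕ) - (b : ℕ) - 1 := ⟨⟨(a : ℕ) - (b : ℕ) - 1, by have := a.isLt; omega⟩, rfl⟩
      have e := congr_fun (hcomp k).2 ⟨(b : ℕ), by omega⟩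
      rw [hdm ((k : ℕ) + 1) x.1 _ a b (by first | omega | (simp; omega)) rfl, Pi.zero_apply] at e
      exact e
  have h1 := LinearMap.finrank_le_finrank_of_injective hΦ
  rw [Module.finrank_pi_fintype] at h1
  simpa [Module.finrank_prod] using h1

/-- `finrank_le_sum` with the sum written over `Finset.range (n − 1)` (convenient for numeric unrolling by `Finset.sum_range_succ`). -/
theorem finrank_le_sum_range {n : ℕ} (W : Submodule ℂ (Matrix (Fin n) (Fin n) ℂ)) (hW : ∀ A ∈ W, IsNilpotent A)
    (hgr : ∀ A ∈ W, ∀ d : ℤ, (Matrix.of fun a b : Fin n => if (b : ℤ) - (a : ℤ) = d then A a b else 0) ∈ W)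
    (dp dm : ∀ h : ℕ, Matrix (Fin n) (Fin n) ℂ →ₗ[ℂ] (Fin (n - h) → ℂ))
    (hdp : ∀ h A (i : Fin (n - h)) (a b : Fin n), (a : ℕ) = i → (b : ℕ) = i + h → dp h A i = A a b)
    (hdm : ∀ h A (i : Fin (n - h)) (a b : Fin n), (a : ℕ) = i + h → (b : ℕ) = i → dm h A i = A a b) :
    Module.finrank ℂ W ≤ ∑ h ∈ Finset.range (n - 1),
      (Module.finrank ℂ (W.map (dp (h + 1))) + Module.finrank ℂ (W.map (dm (h + 1)))) := by
  have h := finrank_le_sum W hW hgr dp dm hdp hdm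
  rw [Fin.sum_univ_eq_sum_range (fun h => Module.finrank ℂ (W.map (dp (h + 1))) + Module.finrank ℂ (W.map (dm (h + 1)))) (n - 1)] at h
  exact h

end Summit.ValiantsHypothesis.ValiantsHypothesis.Theorems.GrenetZeon.HeavyTopThmCnGradedCount

end
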